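import Literature.NumberTheory.EllipticCurves.TorsionFrobeniusProofs
import Literature.NumberTheory.EllipticCurves.IsogenyFrobeniusTraceProofs
import Literature.NumberTheory.EllipticCurves.IsogenyQuotientCurveProofs
import Literature.NumberTheory.EllipticCurves.TateModuleFreeProofs
import Literature.NumberTheory.EllipticCurves.OrdinaryPrimesProofs
import HarnessLib

/-!
# Katz 1981, Theorem 2 for elliptic curves over `ℚ`, prime-power level: the two elliptic-curve
# ends of the argument (Frobenius congruences ⇒ `ℓⁿ ∣ det(1 − ρ(σ))`; a Katz lattice ⇒ a
# rational point of order `ℓᵃ` on an isogenous curve)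

Topic `Literature/NumberTheory/EllipticCurves`; theorems only (no definition, no named fact, no
instance). Companion of `Literature.NumberTheory.GaloisRepresentations.KatzDetCongruenceLattice`
(Katz 1981, Thm. 1, the lattice theorem, proved there in matrix form) and of
`Literature.NumberTheory.EllipticCurves.EisensteinCongruenceRationalTorsionProofs` (the case
`n = 1`). N. M. Katz, *Galois properties of torsion points on abelian varieties*, Invent. Math.
62 (1981), **Theorem 2** (for `E/ℚ`): *if `ℓⁿ ∣ #Ẽ(𝔽_r)` for all good primes `r` outside a finite
set, there is an elliptic curve `E'` `ℚ`-isogenous to `E` with `ℓⁿ ∣ #E'(ℚ)_tors`* (restated as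
Cullinan–Kenney–Voight 2022, Thm. 2.3.1: `ρ_{E',ℓ}(Γ_ℚ) ≤ G(n; r, n − r)`, "in particular
`ℓⁿ ∣ #E'(K)_tor`"). This file proves the two elliptic-curve ends of Katz's proof, in coordinates
with respect to a `ℤ_ℓ`-basis `bT` of the Tate module `T_ℓ E` (a free `ℤ_ℓ`-module of rank `2`,
tree theorems `module_free_tateModule_holds`, `finrank_tateModule_eq_two_holds`):

* `pow_dvd_det_one_sub_toMatrix_galoisRepTate` — **the hypothesis of Katz's Thm. 1 from the
  point counts**: for a globally minimal `E/ℚ`, if `ℓⁿ ∣ a_r − r − 1` (i.e. `ℓⁿ ∣ #Ẽ(𝔽_r)`) for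
  every good prime `r ≠ ℓ` outside a finite set `S`, then `ℓⁿ ∣ det(1 − ρ_{E,ℓ}(σ))` for EVERY
  `σ ∈ Γ_ℚ`. Proof: `det(1 − ρ(φ)) = 1 − tr ρ(φ) + det ρ(φ) = 1 − a_r + r` for an arithmetic
  Frobenius `φ` at a good `r ≠ ℓ` (tree: `trace_galoisRepTate_frobenius_eq_frobeniusTrace`,
  `det_galoisRepTate_frobenius_of_hasGoodReductionAt_holds`, Silverman C.21 Remark 21.3); every
  `σ` acts on `E[ℓⁿ]` as a power `φʲ` of such a Frobenius (Frobenius' density theorem in division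
  form, tree `exists_frobenius_pow_smul_eq_geomTorsion`), so `ρ(σ) ≡ ρ(φ)ʲ (mod ℓⁿ)` entrywise
  (`ker(T_ℓ E → E[ℓⁿ]) = ℓⁿ T_ℓ E`, `TateModule.exists_eq_pow_smul_of_proj_eq_zero`), and
  `det(1 − F) ∣ det(1 − Fʲ)`.
* `exists_isogeny_addOrderOf_eq_pow_of_lattice` — **from a Katz lattice to rational torsion**:
  if `P ∈ M₂(ℤ_ℓ)`, `det P ≠ 0`, conjugates the matrices of `ρ_{E,ℓ}` into matrices `ρ'(σ)` with
  `ℓ^{e i} ∣ (ρ'(σ) − 1)_{ij}` (the rows of `ρ' − 1` divisible by `ℓ^{e₀}`, `ℓ^{e₁}`: Katz's group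
  `G(e₀ + e₁; e₀, e₁)`), then for each `i₀` some elliptic curve `E'`, `ℚ`-isogenous to `E`, has a
  rational point of order exactly `ℓ^{e i₀}`. Proof (Katz, loc. cit., Introduction and proof of
  Thm. 2; Cullinan–Kenney–Voight (2.3.3)): with `𝓛 = P ℤ_ℓ² ⊇ 𝓛' = P diag(ℓ^{eᵢ}) ℤ_ℓ²` (both
  `Γ_ℚ`-stable, `Γ_ℚ` trivial on `𝓛/𝓛'`) and `k` large (`ℓᵏ T_ℓ E ⊆ 𝓛'`), the finite
  `Γ_ℚ`-stable subgroup `C' = pr_k(𝓛') ⊆ E[ℓᵏ]` is the kernel of an isogeny `g : E → E' = E/C'`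
  over `ℚ` (Silverman III.4.12, tree `exists_isogeny_ker_eq_and_comp_eq_nsmul_holds`); the image
  `g(pr_k(u))` of the `i₀`-th column `u` of `P` is `Γ_ℚ`-fixed (`σ u − u ∈ 𝓛'`), killed by
  `ℓ^{e i₀}` (`ℓ^{e i₀} u ∈ 𝓛'`) and not by `ℓ^{e i₀ − 1}` (`ℓ^{e i₀ − 1} u ∉ 𝓛' + ℓᵏ T = 𝓛'`),
  hence (Galois descent, `fixedPoints_eq_range_map_holds`) a rational point of order `ℓ^{e i₀}`.

The assembly with Katz's Thm. 1 and Mazur's torsion theorem is the sibling file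
`KatzPrimePowerEisensteinTorsionProofs`.

## References

* [Katz1980] N. M. Katz, *Galois properties of torsion points on abelian varieties*, Invent.
  Math. 62 (1981) 481–502, Thm. 2 (and Introduction: Galois-stable lattices and isogenies).
* [CullinanKenneyVoight2022] J. Cullinan, M. Kenney, J. Voight, *On a probabilistic local-global
  principle for torsion on elliptic curves*, J. Théor. Nombres Bordeaux 34 (2022), Thm. 2.3.1 and
  (2.3.3).
* [SilvermanAEC2009] J. H. Silverman, *The Arithmetic of Elliptic Curves*, 2nd ed.: III.4.12,
  III.§7, VII.4.1, VIII.§1, C.21 Remark 21.3.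
-/

noncomputable section

open scoped Classical Matrix

open NumberField IsDedekindDomain Field WeierstrassCurve

namespace Literature.NumberTheory.EllipticCurves

/-! ### A. Lemmas: the kernel of `T_ℓ A → A[ℓⁿ]`, and two `2 × 2` determinant facts -/

section Lemmas

variable {A : Type*} [AddCommGroup A] {p : ℕ} [Fact p.Prime]

/-- **`ker (T_p A → A[pⁿ]) = pⁿ T_p A`**: an element of the Tate module with vanishing `n`-th
component is divisible by `pⁿ` (iterate `TateModule.div`). Silverman, *AEC*, III.§7. [folklore] -/
theorem TateModule.exists_eq_pow_smul_of_proj_eq_zero (n : ℕ) (a : TateModule A p)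
    (h : TateModule.proj p n a = 0) : ∃ b : TateModule A p, a = (p : ℤ_[p]) ^ n • b := by
  induction n generalizing a with
  | zero => exact ⟨a, by rw [pow_zero, one_smul]⟩
  | succ n ih =>
    have h1 : TateModule.proj p 1 a = 0 := by
      rw [← TateModule.pow_smul_proj_self_add n 1 a, h, smul_zero]
    obtain ⟨b, hb⟩ := ih (TateModule.div a h1) (by rw [TateModule.proj_div]; exact h)
    refine ⟨b, ?_⟩
    rw [← TateModule.p_smul_div a h1, hb, smul_smul, ← pow_succ']

/-- If two `2 × 2` matrices agree modulo `t`, so do `det(1 − ·)` of them. [folklore] -/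
theorem dvd_det_one_sub_of_forall_dvd_sub {R : Type*} [CommRing R] (t : R)
    {M N : Matrix (Fin 2) (Fin 2) R} (h : ∀ i j, t ∣ M i j - N i j) (hN : t ∣ (1 - N).det) :
    t ∣ (1 - M).det := by
  have hm : ∀ i j, ∃ m, M i j = N i j + t * m := fun i j ↦ by
    obtain ⟨m, hm⟩ := h i j
    exact ⟨m, by linear_combination hm⟩
  choose m hm using hm
  have key : (1 - M).det = (1 - N).det + t * (-(m 1 1 * (1 - N 0 0)) - m 0 0 * (1 - N 1 1) +
      t * m 0 0 * m 1 1 - N 0 1 * m 1 0 - m 0 1 * N 1 0 - t * m 0 1 * m 1 0) := by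
    simp only [Matrix.det_fin_two, Matrix.sub_apply, hm]
    simp
    ring
  rw [key]
  exact dvd_add hN (dvd_mul_right t _)

/-- `det(1 − F) ∣ det(1 − Fʲ)` (`1 − Fʲ = (1 + F + ⋯ + F^{j−1})(1 − F)`). [folklore] -/
theorem det_one_sub_dvd_det_one_sub_pow {R : Type*} [CommRing R] (F : Matrix (Fin 2) (Fin 2) R)
    (j : ℕ) : (1 - F).det ∣ (1 - F ^ j).det := by
  have h : (∑ i ∈ Finset.range j, F ^ i) * (1 - F) = 1 - F ^ j := by
    rw [show (1 - F) = -(F - 1) from (neg_sub F 1).symm, mul_neg, geom_sum_mul, neg_sub]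
  rw [← h, Matrix.det_mul]
  exact dvd_mul_left _ _

end Lemmas

/-! ### B. The hypothesis of Katz's theorem from the Frobenius congruences -/

section Hypothesis

variable (W : WeierstrassCurve ℚ) [W.IsElliptic] [W.IsGloballyMinimal] (ℓ : ℕ) [Fact ℓ.Prime]

/-- **`ℓⁿ ∣ #Ẽ(𝔽_r)` at almost all good `r` forces `ℓⁿ ∣ det(1 − ρ_{E,ℓ}(σ))` for every
`σ ∈ Γ_ℚ`** (the hypothesis of Katz 1981, Thm. 1, from that of Thm. 2; Katz, loc. cit., and
Cullinan–Kenney–Voight 2022, proof of Thm. 2.3.1: "by the Chebotarev density theorem" — here by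
Frobenius' density theorem in division form). `W` globally minimal, `a_r = W.frobeniusTrace r`;
matrices with respect to any `ℤ_ℓ`-basis `bT` of `T_ℓ E`.
[cite: Katz1980, Thm. 2 (proof)] [cite: CullinanKenneyVoight2022, Thm. 2.3.1 (proof)] [cite: SilvermanAEC2009, C.21 Remark 21.3] -/
theorem pow_dvd_det_one_sub_toMatrix_galoisRepTate
    (bT : Module.Basis (Fin 2) ℤ_[ℓ] (W.tateModule ℓ)) {n : ℕ} (S : Set ℕ) (hS : S.Finite)
    (hcongr : ∀ (r : ℕ) [Fact r.Prime], r ≠ ℓ → r ∉ S → W.HasGoodReductionAtPrime r →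
      ((ℓ ^ n : ℕ) : ℤ) ∣ W.frobeniusTrace r - (r + 1))
    (σ : absoluteGaloisGroup ℚ) :
    (ℓ : ℤ_[ℓ]) ^ n ∣ (1 - LinearMap.toMatrix bT bT (W.galoisRepTate ℓ σ)).det := by
  classical
  have hℓ : ℓ.Prime := Fact.out
  -- the matrices of the Galois action, as a homomorphism
  let M : absoluteGaloisGroup ℚ →* Matrix (Fin 2) (Fin 2) ℤ_[ℓ] :=
    { toFun := fun τ ↦ LinearMap.toMatrix bT bT (W.galoisRepTate ℓ τ)
      map_one' := by rw [map_one, LinearMap.toMatrix_one]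
      map_mul' := fun a b ↦ by rw [map_mul, LinearMap.toMatrix_mul] }
  have hM : ∀ τ, M τ = LinearMap.toMatrix bT bT (W.galoisRepTate ℓ τ) := fun τ ↦ rfl
  have hMij : ∀ τ (i j : Fin 2), M τ i j = bT.repr (τ • bT j) i := fun τ i j ↦ by
    rw [hM, LinearMap.toMatrix_apply, galoisRepTate_apply_apply]
  rw [← hM]
  -- the excluded primes: `S`, `ℓ`, and the primes of bad reduction
  have hΔ0 : minimalDiscriminantInt W ≠ 0 := minimalDiscriminantInt_ne_zero W
  let S₀ : Set ℕ := S ∪ {r | r = ℓ ∨ (r : ℤ) ∣ minimalDiscriminantInt W}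
  have hS₀ : S₀.Finite := by
    refine hS.union ((Set.finite_le_nat (max ℓ (minimalDiscriminantInt W).natAbs)).subset ?_)
    rintro r (rfl | hr)
    · exact Set.mem_setOf.mpr (le_max_left _ _)
    · exact Set.mem_setOf.mpr (le_max_of_le_right
        (Nat.le_of_dvd (Int.natAbs_pos.mpr hΔ0) (Int.natCast_dvd.mp hr)))
  obtain ⟨r, v, 𝔓, φ, hr, hrS₀, hv, h𝔓, hφ, j, hagree⟩ :=
    exists_frobenius_pow_smul_eq_geomTorsion W (n := ((ℓ ^ n : ℕ) : ℤ))
      (by exact_mod_cast pow_ne_zero n hℓ.ne_zero) S₀ hS₀ σ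
  haveI : Fact r.Prime := ⟨hr⟩
  have hrS : r ∉ S := fun h ↦ hrS₀ (Or.inl h)
  have hrℓ : r ≠ ℓ := fun h ↦ hrS₀ (Or.inr (Or.inl h))
  have hrΔ : ¬ (r : ℤ) ∣ minimalDiscriminantInt W := fun h ↦ hrS₀ (Or.inr (Or.inr h))
  have hgood : W.HasGoodReductionAtPrime r := hasGoodReductionAtPrime_of_not_dvd W r hrΔ
  have hc := hcongr r hrℓ hrS hgood
  have hvr : (Rat.HeightOneSpectrum.primesEquiv v : ℕ) = r := primesEquiv_eq_of_natCast_mem hr hv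
  -- `det(1 − M φ) = 1 − a_r + r ≡ 0`
  have hdvdφ : (ℓ : ℤ_[ℓ]) ^ n ∣ (1 - M φ).det := by
    subst hvr
    have hne : (Rat.HeightOneSpectrum.primesEquiv v : ℕ) ≠ ℓ := hrℓ
    have hgood' : W.HasGoodReductionAt v :=
      (hasGoodReductionAtPrime_iff_hasGoodReductionAt_ringOfIntegers v W).mp hgood
    have hℓv : (ℓ : 𝓞 ℚ) ∉ v.asIdeal := natCast_not_mem_asIdeal_of_primesEquiv_ne hℓ hne
    have htr : (M φ).trace = (W.frobeniusTrace (Rat.HeightOneSpectrum.primesEquiv v) : ℤ_[ℓ]) := by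
      rw [hM, ← LinearMap.trace_eq_matrix_trace ℤ_[ℓ] bT,
        trace_galoisRepTate_frobenius_eq_frobeniusTrace W ℓ hne hgood' h𝔓 hφ]
    have hdetφ : (M φ).det = ((Rat.HeightOneSpectrum.primesEquiv v : ℕ) : ℤ_[ℓ]) := by
      rw [hM, LinearMap.det_toMatrix,
        det_galoisRepTate_frobenius_of_hasGoodReductionAt_holds W ℓ v hℓv hgood' h𝔓 hφ,
        natCard_residueField_adicCompletionIntegers]
    have h1 : (1 - M φ).det = 1 - (M φ).trace + (M φ).det := by
      rw [Matrix.det_fin_two, Matrix.det_fin_two, Matrix.trace_fin_two]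
      simp
      ring
    rw [h1, htr, hdetφ]
    obtain ⟨c, hc'⟩ := hc
    refine ⟨-(c : ℤ_[ℓ]), ?_⟩
    have h2 := congrArg (fun z : ℤ ↦ (z : ℤ_[ℓ])) hc'
    push_cast at h2
    linear_combination -h2
  -- `det(1 − M (φ ^ j)) ≡ 0`
  have hdvdj : (ℓ : ℤ_[ℓ]) ^ n ∣ (1 - M (φ ^ j)).det := by
    rw [map_pow]
    exact hdvdφ.trans (det_one_sub_dvd_det_one_sub_pow (M φ) j)
  -- `M σ ≡ M (φ ^ j)` modulo `ℓⁿ`, from `σ = φ ^ j` on `E[ℓⁿ]`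
  refine dvd_det_one_sub_of_forall_dvd_sub _ (fun i i' ↦ ?_) hdvdj
  have hx : ∀ x : W.tateModule ℓ, ∃ z : W.tateModule ℓ,
      σ • x - (φ ^ j) • x = (ℓ : ℤ_[ℓ]) ^ n • z := by
    intro x
    apply TateModule.exists_eq_pow_smul_of_proj_eq_zero
    rw [map_sub, TateModule.proj_smul_of_distribMulAction,
      TateModule.proj_smul_of_distribMulAction, sub_eq_zero]
    have h := congrArg Subtype.val
      (hagree ⟨TateModule.proj ℓ n x, proj_tateModule_mem_geomTorsion W ℓ n x⟩)
    rw [AddSubgroup.torsionBy.coe_smul, AddSubgroup.torsionBy.coe_smul] at h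
    exact h
  obtain ⟨z, hz⟩ := hx (bT i')
  have hcz := congrArg (fun y ↦ bT.repr y i) hz
  simp only [map_sub, map_smul, Finsupp.sub_apply, Finsupp.smul_apply, smul_eq_mul] at hcz
  rw [hMij, hMij]
  exact ⟨bT.repr z i, hcz⟩

end Hypothesis

/-! ### C. From a Katz lattice to a rational point of prime-power order on an isogenous curve -/

section Lattice

variable (W : WeierstrassCurve ℚ) [W.IsElliptic] (ℓ : ℕ) [Fact ℓ.Prime]

/-- **From Katz's group `G(n; e₀, e₁)` to rational torsion** (Katz 1981, Introduction and proof
of Thm. 2; Cullinan–Kenney–Voight 2022, (2.3.3)). Let `bT` be a `ℤ_ℓ`-basis of `T_ℓ E`,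
`P ∈ M₂(ℤ_ℓ)` with `det P ≠ 0`, and suppose that for every `σ ∈ Γ_ℚ` the matrix `[σ]_{bT}`
satisfies `[σ] P = P ρ'(σ)` with `ℓ^{e i} ∣ (ρ'(σ) − 1)_{ij}` for all `i, j`. Then for each `i₀`
there are an elliptic curve `E'` over `ℚ`, an isogeny `E → E'` over `ℚ`, and a rational point
of `E'` of order exactly `ℓ^{e i₀}`: `E' = E / pr_k(𝓛')` for `𝓛' = P diag(ℓ^{eᵢ}) ℤ_ℓ²` and
`k = v_ℓ(det P) + e₀ + e₁`, the point being the image of the `k`-th component of the `i₀`-th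
column of `P`. [cite: Katz1980, Thm. 2 (proof) and Introduction] [cite: CullinanKenneyVoight2022, Thm. 2.3.1, (2.3.3)] [cite: SilvermanAEC2009, Prop. III.4.12 with Rem. III.4.13.2; VIII.§1] -/
theorem exists_isogeny_addOrderOf_eq_pow_of_lattice
    (bT : Module.Basis (Fin 2) ℤ_[ℓ] (W.tateModule ℓ)) {P : Matrix (Fin 2) (Fin 2) ℤ_[ℓ]}
    (hP : P.det ≠ 0) (e : Fin 2 → ℕ)
    (ρ' : absoluteGaloisGroup ℚ → Matrix (Fin 2) (Fin 2) ℤ_[ℓ])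
    (hconj : ∀ σ, LinearMap.toMatrix bT bT (W.galoisRepTate ℓ σ) * P = P * ρ' σ)
    (hshape : ∀ σ i j, (ℓ : ℤ_[ℓ]) ^ e i ∣ (ρ' σ - 1) i j) (i₀ : Fin 2) :
    ∃ (W' : WeierstrassCurve ℚ) (_ : W'.IsElliptic) (_ : Isogeny W W') (Q : W'.toAffine.Point),
      addOrderOf Q = ℓ ^ e i₀ := by
  classical
  have hℓ : ℓ.Prime := Fact.out
  set L : ℤ_[ℓ] := (ℓ : ℤ_[ℓ]) with hL
  have hl : L ≠ 0 := Nat.cast_ne_zero.mpr hℓ.ne_zero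
  -- coordinates
  set c : W.tateModule ℓ ≃ₗ[ℤ_[ℓ]] (Fin 2 → ℤ_[ℓ]) := bT.equivFun with hc
  have hcσ : ∀ (σ : absoluteGaloisGroup ℚ) (x : W.tateModule ℓ),
      c (σ • x) = LinearMap.toMatrix bT bT (W.galoisRepTate ℓ σ) *ᵥ c x := by
    intro σ x
    have h1 := LinearMap.toMatrix_mulVec_repr bT bT (W.galoisRepTate ℓ σ) x
    rw [galoisRepTate_apply_apply] at h1
    rw [hc, Module.Basis.equivFun_apply, Module.Basis.equivFun_apply, ← h1]
  -- the lattice map `w ↦ c⁻¹ (P D w)`, `D = diag(ℓ^{e i})`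
  set D : Matrix (Fin 2) (Fin 2) ℤ_[ℓ] := Matrix.diagonal fun i ↦ L ^ e i with hD
  have hDv : ∀ (w : Fin 2 → ℤ_[ℓ]) i, (D *ᵥ w) i = L ^ e i * w i := fun w i ↦ by
    rw [hD, Matrix.mulVec_diagonal]
  set lat : (Fin 2 → ℤ_[ℓ]) →ₗ[ℤ_[ℓ]] W.tateModule ℓ :=
    c.symm.toLinearMap ∘ₗ (P * D).mulVecLin with hlat
  have hclat : ∀ w, c (lat w) = P *ᵥ (D *ᵥ w) := fun w ↦ by
    simp [hlat]
  -- rows of `ρ' σ - 1`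
  have hrow : ∀ σ, ∃ y : Matrix (Fin 2) (Fin 2) ℤ_[ℓ], ∀ i j,
      ρ' σ i j = (1 : Matrix (Fin 2) (Fin 2) ℤ_[ℓ]) i j + L ^ e i * y i j := by
    intro σ
    choose y hy using hshape σ
    refine ⟨Matrix.of y, fun i j ↦ ?_⟩
    have := hy i j
    rw [Matrix.sub_apply] at this
    rw [Matrix.of_apply]
    linear_combination this
  -- `ρ' σ (D w) = D w'`
  have hρ'D : ∀ σ w, ∃ w', ρ' σ *ᵥ (D *ᵥ w) = D *ᵥ w' := by
    intro σ w
    obtain ⟨y, hy⟩ := hrow σ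
    refine ⟨fun i ↦ w i + ∑ j, y i j * (L ^ e j * w j), funext fun i ↦ ?_⟩
    rw [hDv, Matrix.mulVec, dotProduct]
    simp only [hDv, hy, Fin.sum_univ_two]
    fin_cases i <;> simp [Matrix.one_apply] <;> ring
  have hlat_smul : ∀ (σ : absoluteGaloisGroup ℚ) w, ∃ w', σ • lat w = lat w' := by
    intro σ w
    obtain ⟨w', hw'⟩ := hρ'D σ w
    refine ⟨w', c.injective ?_⟩
    rw [hcσ, hclat, hclat, Matrix.mulVec_mulVec, hconj, ← Matrix.mulVec_mulVec, hw']
  -- the level `k`, with `ℓᵏ T ⊆ lat(ℤ_ℓ²)`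
  set d : ℕ := (P.det).valuation with hd
  set k : ℕ := d + (e 0 + e 1) with hk
  have hkT : ∀ x : W.tateModule ℓ, ∃ w, L ^ k • x = lat w := by
    intro x
    set υ : ℤ_[ℓ]ˣ := PadicInt.unitCoeff hP with hυ
    have hdet : P.det = (υ : ℤ_[ℓ]) * L ^ d := PadicInt.unitCoeff_spec hP
    set s : Fin 2 → ℤ_[ℓ] := ((υ⁻¹ : ℤ_[ℓ]ˣ) : ℤ_[ℓ]) • (P.adjugate *ᵥ c x) with hs
    have hPs : P *ᵥ s = L ^ d • c x := by
      rw [hs, Matrix.mulVec_smul, Matrix.mulVec_mulVec, Matrix.mul_adjugate, Matrix.smul_mulVec,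
        Matrix.one_mulVec, smul_smul, hdet, ← mul_assoc, Units.inv_mul, one_mul]
    refine ⟨fun i ↦ L ^ (e 0 + e 1 - e i) * s i, c.injective ?_⟩
    rw [map_smul, hclat]
    have hDw : D *ᵥ (fun i ↦ L ^ (e 0 + e 1 - e i) * s i) = L ^ (e 0 + e 1) • s := by
      funext i
      rw [hDv, Pi.smul_apply, smul_eq_mul, ← mul_assoc, ← pow_add,
        Nat.add_sub_cancel' (by fin_cases i <;> simp : e i ≤ e 0 + e 1)]
    rw [hDw, Matrix.mulVec_smul, hPs, smul_smul, ← pow_add, hk, add_comm]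
  -- the finite `Γ`-stable subgroup `S' = pr_k (lat ℤ_ℓ²)`
  set f : (Fin 2 → ℤ_[ℓ]) →+ W.geomPoints := (TateModule.proj ℓ k).comp lat.toAddMonoidHom
    with hf
  set S' : AddSubgroup W.geomPoints := f.range with hS'
  have hS'mem : ∀ Q, Q ∈ S' ↔ ∃ w, TateModule.proj ℓ k (lat w) = Q := fun Q ↦ by
    rw [hS', AddMonoidHom.mem_range]
    rfl
  have hsub : ∀ Q, Q ∈ S' → Q ∈ W.geomTorsion ((ℓ ^ k : ℕ) : ℤ) := by
    intro Q hQ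
    obtain ⟨w, rfl⟩ := (hS'mem Q).mp hQ
    exact proj_tateModule_mem_geomTorsion W ℓ k (lat w)
  have hS'fin : (S' : Set W.geomPoints).Finite := by
    haveI : Finite (W.geomTorsion ((ℓ ^ k : ℕ) : ℤ)) :=
      finite_torsionPoints_algebraicClosure W (by exact_mod_cast pow_ne_zero k hℓ.ne_zero)
    haveI : Finite S' := Finite.of_injective
      (fun Q : S' ↦ (⟨Q.1, hsub Q.1 Q.2⟩ : W.geomTorsion ((ℓ ^ k : ℕ) : ℤ)))
      (fun a b h ↦ Subtype.ext (by have h' := congrArg Subtype.val h; exact h'))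
    exact Set.toFinite _
  have hS'stab : ∀ (σ : absoluteGaloisGroup ℚ) (Q : W.geomPoints), Q ∈ S' → σ • Q ∈ S' := by
    intro σ Q hQ
    obtain ⟨w, rfl⟩ := (hS'mem Q).mp hQ
    obtain ⟨w', hw'⟩ := hlat_smul σ w
    exact (hS'mem _).mpr ⟨w', by rw [← hw', TateModule.proj_smul_of_distribMulAction]⟩
  obtain ⟨W', hW', g, -, hker, -, -⟩ :=
    exists_isogeny_ker_eq_and_comp_eq_nsmul_holds W S' hS'fin hS'stab
  haveI := hW'
  have hgker : ∀ x : W.tateModule ℓ, g (TateModule.proj ℓ k x) = 0 ↔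
      ∃ w, TateModule.proj ℓ k (lat w) = TateModule.proj ℓ k x := by
    intro x
    rw [← hS'mem, ← hker, AddMonoidHom.mem_ker]
    rfl
  -- the `i₀`-th column `u` of `P` and the point `g (pr_k u)`
  set u : W.tateModule ℓ := c.symm (P *ᵥ Pi.single i₀ 1) with hu
  have hcu : c u = P *ᵥ Pi.single i₀ 1 := by rw [hu, LinearEquiv.apply_symm_apply]
  set R : W.geomPoints := TateModule.proj ℓ k u with hR
  -- (i) `g R` is `Γ_ℚ`-fixed: `σ u − u ∈ 𝓛'`
  have hfix : ∀ σ : absoluteGaloisGroup ℚ, σ • g R = g R := by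
    intro σ
    rw [← Isogeny.map_smul, hR, ← TateModule.proj_smul_of_distribMulAction, ← sub_eq_zero,
      ← map_sub, ← map_sub, hgker]
    obtain ⟨y, hy⟩ := hrow σ
    refine ⟨fun i ↦ y i i₀, ?_⟩
    congr 1
    apply c.injective
    rw [hclat, map_sub, hcσ, hcu, Matrix.mulVec_mulVec (Pi.single i₀ 1) _ P, hconj,
      ← Matrix.mulVec_mulVec, ← Matrix.mulVec_sub]
    congr 1
    funext i
    rw [hDv, Pi.sub_apply, Matrix.mulVec_single_one, Matrix.col_apply, hy]
    rcases eq_or_ne i i₀ with rfl | hne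
    · simp
    · rw [Pi.single_eq_of_ne hne, Matrix.one_apply_ne hne]
      ring
  -- (ii) `ℓ^{e i₀} • g R = 0`: `ℓ^{e i₀} u ∈ 𝓛'`
  have hsmul_u : ∀ m : ℕ, c (ℓ ^ m • u) = L ^ m • (P *ᵥ Pi.single i₀ 1) := fun m ↦ by
    rw [← Nat.cast_smul_eq_nsmul ℤ_[ℓ], map_smul, hcu, Nat.cast_pow]
  have htors : ℓ ^ e i₀ • g R = 0 := by
    rw [← map_nsmul, hR, ← map_nsmul, hgker]
    refine ⟨Pi.single i₀ 1, ?_⟩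
    congr 1
    apply c.injective
    rw [hclat, hsmul_u, ← Matrix.mulVec_smul]
    congr 1
    funext i
    rw [hDv, Pi.smul_apply, smul_eq_mul]
    simp only [Pi.single_apply]
    split_ifs with h
    · subst h; ring
    · ring
  -- the case `e i₀ = 0`
  rcases Nat.eq_zero_or_pos (e i₀) with h0 | hpos
  · exact ⟨W, inferInstance, Isogeny.id W, 0, by rw [h0, pow_zero, addOrderOf_zero]⟩
  obtain ⟨m, hm⟩ : ∃ m, e i₀ = m + 1 := ⟨e i₀ - 1, by omega⟩
  -- (iii) `ℓ^m • g R ≠ 0`: `ℓ^m u ∉ 𝓛' + ℓᵏ T = 𝓛'`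
  have hne : ¬ ℓ ^ m • g R = 0 := by
    intro h0
    rw [← map_nsmul, hR, ← map_nsmul, hgker] at h0
    obtain ⟨w, hw⟩ := h0
    have h1 : TateModule.proj ℓ k (lat w - ℓ ^ m • u) = 0 := by rw [map_sub, hw, sub_self]
    obtain ⟨z, hz⟩ := TateModule.exists_eq_pow_smul_of_proj_eq_zero k _ h1
    obtain ⟨w₂, hw₂⟩ := hkT z
    -- in coordinates: `P (D w) − L^m P e_{i₀} = P (D w₂)`
    have h2 : P *ᵥ (D *ᵥ w - L ^ m • Pi.single i₀ 1 - D *ᵥ w₂) = 0 := by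
      rw [Matrix.mulVec_sub, Matrix.mulVec_sub, Matrix.mulVec_smul, ← hclat, ← hsmul_u, ← hclat,
        ← hw₂, ← hz, map_sub, sub_self]
    -- cancel `P`
    have h3 := congrArg (fun t ↦ (P.adjugate *ᵥ t) i₀) h2
    rw [Matrix.mulVec_mulVec, Matrix.adjugate_mul, Matrix.mulVec_zero, Pi.zero_apply,
      Matrix.smul_mulVec, Matrix.one_mulVec, Pi.smul_apply, smul_eq_mul, Pi.sub_apply,
      Pi.sub_apply, hDv, hDv, Pi.smul_apply, smul_eq_mul, hm, Pi.single_eq_same, mul_one] at h3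
    have h4 : L ^ (m + 1) * w i₀ - L ^ m - L ^ (m + 1) * w₂ i₀ = 0 :=
      (mul_eq_zero.mp h3).resolve_left hP
    have h5 : L * (w i₀ - w₂ i₀) = 1 := by
      have h6 : L ^ m * (L * (w i₀ - w₂ i₀) - 1) = 0 := by
        rw [← h4]; ring
      exact sub_eq_zero.mp ((mul_eq_zero.mp h6).resolve_left (pow_ne_zero m hl))
    exact PadicInt.p_nonunit (IsUnit.of_mul_eq_one _ h5)
  have hord : addOrderOf (g R) = ℓ ^ (m + 1) := addOrderOf_eq_prime_pow hne (hm ▸ htors)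
  -- (iv) Galois descent
  have hfixpt : g R ∈ MulAction.fixedPoints (absoluteGaloisGroup ℚ) W'.geomPoints := by
    rw [MulAction.mem_fixedPoints]
    exact hfix
  rw [fixedPoints_eq_range_map_holds W'] at hfixpt
  obtain ⟨Q, hQ⟩ := hfixpt
  have h1 : addOrderOf (Affine.Point.map (W' := W'.toAffine) (S := ℚ)
      (Algebra.ofId ℚ (AlgebraicClosure ℚ)) Q) = addOrderOf Q :=
    addOrderOf_injective _ (Affine.Point.map_injective (W' := W'.toAffine)
      (f := Algebra.ofId ℚ (AlgebraicClosure ℚ))) Q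
  have hQ' : Affine.Point.map (W' := W'.toAffine) (S := ℚ)
      (Algebra.ofId ℚ (AlgebraicClosure ℚ)) Q = g R := hQ
  have h2 : addOrderOf (Affine.Point.map (W' := W'.toAffine) (S := ℚ)
      (Algebra.ofId ℚ (AlgebraicClosure ℚ)) Q) = ℓ ^ e i₀ := by
    rw [hQ']
    exact hord.trans (by rw [hm])
  exact ⟨W', hW', g, Q, h1.symm.trans h2⟩

end Lattice

end Literature.NumberTheory.EllipticCurves

end
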